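import Literature.Computability.Complexity.NCThreshold
import Literature.Computability.Complexity.ThresholdWeightBound
import HarnessLib

/-!
# The threshold gadget for `TC⁰ ⊆ NC¹`: arbitrary-weight thresholds in logarithmic depth over `B₂`

The one arithmetic ingredient of `TC⁰ ⊆ NC¹` in the tree's circuit model
(`TC0SubsetNC1Reduction.TC0_subset_NC1_of_gadget`, hypothesis `HG`): **every weighted threshold
`[θ ≤ ∑ⱼ wⱼ yⱼ]` of `M` Boolean variables, with ARBITRARY natural weights, has a `B₂`-circuit of
depth `O(log M)` and size `M^{O(1)}`** (`ncVec_thresholdGate`, `ncVec_wthreshold_of_le`).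

Arbitrary weights are forced by the model: a gate may read the same wire many times
(`Gate.args` need not be injective; Vollmer's Def. 1.6 circuits are simple DAGs), so a `MAJₖ`
gate of a small circuit is a weighted majority of its distinct argument wires with unbounded
multiplicities. The gadget therefore first reduces the weights to naturals `≤ (M+1)!` over
literals by the weight bound of threshold logic (Muroga 1971, Thm. 9.3.2.1; Håstad 1994,
Thm. 3.2; proved as `ThresholdWeights.exists_literal_threshold`), and then evaluates the
threshold by the carry-save / look-ahead circuits of `NCThreshold.lean` (`ncVec_wsumGe`;
Vollmer 1999, Thm. 1.20 and Thm. 1.24) with `(M+1)²`-bit weights: depth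
`simDepth M = 1 + wsumDepth M (M+1)²`, size `simSize M = M + wsumSize M (M+1)²`. The monotone hulls
`N ↦ max_{M ≤ N} simDepth M`, `max_{M ≤ N} simSize M` give the gadget in the exact form `HG`.

## References

* H. Vollmer, *Introduction to Circuit Complexity* (1999), Thm. 1.20, Thm. 1.24, Cor. 4.35
  [Vollmer1999].
* J. Håstad, SIAM J. Discrete Math. 7 (1994), Thm. 3.2 [Hastad1994]; S. Muroga, *Threshold
  Logic and Its Applications* (1971), Thm. 9.3.2.1 [Muroga1971].
-/

namespace Literature.Computability.Complexity

open Finset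

/-- Depth of the bounded fan-in block simulating one threshold gate on `M` slots: a literal
layer and the weighted threshold of `NCThreshold.lean` for `(M+1)²`-bit weights. [folklore] -/
def simDepth (M : ℕ) : ℕ := 1 + wsumDepth M ((M + 1) * (M + 1))

/-- Size of the block simulating one threshold gate on `M` slots. [folklore] -/
def simSize (M : ℕ) : ℕ := M * 1 + wsumSize M ((M + 1) * (M + 1))

/-- `(M+1)! < 2^((M+1)²)`: the reduced weights have `(M+1)²` bits. [folklore] -/
theorem factorial_lt_two_pow_sq (M : ℕ) : (M + 1).factorial < 2 ^ ((M + 1) * (M + 1)) := by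
  calc (M + 1).factorial ≤ (M + 1) ^ (M + 1) := Nat.factorial_le_pow (M + 1)
    _ < (2 ^ (M + 1)) ^ (M + 1) := Nat.pow_lt_pow_left (Nat.lt_two_pow_self) (by omega)
    _ = 2 ^ ((M + 1) * (M + 1)) := by rw [← pow_mul]

/-- A layer of literals `yₚ ⊕ qₚ` (a `¬` gate where `qₚ = 1`): depth `1`, `≤ M` gates. [folklore] -/
theorem ncVec_literals {M : ℕ} (q : Fin M → Bool) :
    NCVec (fun (y : Fin M → Bool) (p : Fin M) => (y p).xor (q p)) 1 (M * 1) :=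
  NCVec.pi_fin fun p => by
    cases hq : q p
    · exact ((ncVec_proj fun _ : Unit => p).congr fun y _ => by simp).mono zero_le_one zero_le_one
    · exact ((ncVec_proj fun _ : Unit => p).gate₁ (! ·) ()).congr fun y _ => by simp

/-- **Every weighted threshold of `M` literals in depth `O(log M)`**, whatever the weights:
`[θ ≤ ∑ₚ mₚ · (yₚ ⊕ polₚ)]` is realized over `B2` at depth `simDepth M` with `simSize M` gates —
reduce the weights to `≤ (M+1)!` (Håstad 1994, Thm. 3.2 / Muroga 1971, in the literal form
`ThresholdWeights.exists_literal_threshold`), then apply `ncVec_wsumGe` (Vollmer 1999,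
Thm. 1.24). [cite: Vollmer1999, Theorem 1.24] -/
theorem ncVec_thresholdGate (M : ℕ) (m : Fin M → ℕ) (pol : Fin M → Bool) (θ : ℕ) :
    NCVec (fun (y : Fin M → Bool) (_ : Unit) =>
        decide (θ ≤ ∑ p, m p * ((y p).xor (pol p)).toNat)) (simDepth M) (simSize M) := by
  obtain ⟨c, pol', θ', hc, heq⟩ := ThresholdWeights.exists_literal_threshold (U := Fin M) m θ
  have hcB : ∀ p, c p < 2 ^ ((M + 1) * (M + 1)) := fun p =>
    (hc p).trans_lt (by rw [Fintype.card_fin]; exact factorial_lt_two_pow_sq M)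
  have h := (ncVec_literals (fun p => (pol p).xor (pol' p))).comp (ncVec_wsumGe M _ c hcB θ')
  refine h.congr fun y _ => ?_
  have h1 := heq (fun p => (y p).xor (pol p))
  rw [h1]
  simp only [Bool.xor_assoc]

/-- **The gadget in hypothesis form** (`HG` of `TC0_subset_NC1_of_gadget`): for `M ≤ N`, every
weighted threshold of `M` variables with natural weights is realized over `B2` at depth
`max_{M' ≤ N} simDepth M'` with `max_{M' ≤ N} simSize M'` gates. [cite: Vollmer1999, Theorem 1.24] -/
theorem ncVec_wthreshold_of_le (N M : ℕ) (hMN : M ≤ N) (w : Fin M → ℕ) (θ : ℕ) :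
    NCVec (fun (y : Fin M → Bool) (_ : Unit) => decide (θ ≤ ∑ j, w j * (y j).toNat))
      ((Finset.range (N + 1)).sup simDepth) ((Finset.range (N + 1)).sup simSize) := by
  have hM : M ∈ Finset.range (N + 1) := Finset.mem_range.2 (Nat.lt_succ_of_le hMN)
  refine ((ncVec_thresholdGate M w (fun _ => false) θ).congr fun y _ => ?_).mono
    (Finset.le_sup (f := simDepth) hM) (Finset.le_sup (f := simSize) hM)
  simp only [Bool.xor_false]

end Literature.Computability.Complexity
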